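import Summits.ValiantsHypothesis.ValiantsHypothesis.Theorems.KPlusLogSqLawTropicalSymmetricOrbitThreeFourV2B
import Summits.ValiantsHypothesis.ValiantsHypothesis.Theorems.KPlusLogSqLawTropicalSymmetricOrbitThreeFour

/-!
# Route «KPlusLogSqLaw» — the symmetric `(3,4)` tropical row in the ORBIT model — abstract exclusion lemmas, part 6:
# the single-term branch of the orbit V2-core (`K10`) and the ORBIT V2-CORE itself (`orbV2`: `{0,0,3}, {0,2,3}, {1,1,2}, {1,2,2}` never all carried)

HONEST FRAMING.  Helper file (seat val-sym-lift-p2 (g6), cell `pub-symmetroid`, 2026-08-27; `--supports` the `WeakLifting` item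
stmt-ValiantsHypothesis-19561 as a helper, no closure claim).  A SMALL-FORMAT statement in the transpose-ORBIT carrier model, far inside the
known regime of the cruxes; port blueprint `HOME/val-sym-lift-p2/g6/LEMMA-Z-liftp2g6.md` §6–§7.  Nothing here is about `TropicalB` /
`WeakLifting` in their windows, Conjecture B, DoorA34 = `PosRootLawAt 3 4 18` (OPEN, never asserted), `MatrixDescartes`
(stmt-ValiantsHypothesis-18050) or VP ≠ VNP; `TSymOrb34Le17` / `TSymOrb34Le16` stay targets (NOT asserted).

THIS FILE.  `DD_023_low` (an identity term on `{0,2,3}` is incomparable with an identity term whose letters are all `1` or `2`), `K10` (all of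
`{0,0,3}, {1,1,2}, {1,2,2}` on transpositions against `{0,2,3} = D`: two of the three transpositions would share a fixed column), and the
assembled **`orbV2`** — the second of the five exclusion cores needed for `TSymOrb34Le17` (with its mirror V1, the orbit Lemma Y `orbY`
(p498614) and the 5-core pair; blueprint §5–§7).
[cell statement R1732; folklore-level exchange arguments, no citation exists]
-/

set_option linter.dupNamespace false
set_option autoImplicit false

namespace Summit.ValiantsHypothesis.ValiantsHypothesis.Theorems.KPlusLogSqLaw

open Summit.ValiantsHypothesis.ValiantsHypothesis.Theorems.MatrixDescartes.Negative
open Summit.ValiantsHypothesis.ValiantsHypothesis.Theorems.LacunarySymmetroidMatrixDescartes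
open Summit.ValiantsHypothesis.ValiantsHypothesis.Theorems.LacunarySymmetroidMatrixDescartes.TropicalCensus
open Finset

namespace SymmetricOrbitThreeFour

open SymmetricThreeFour SymmetricThreeFourSeventeen SymmetricThreeFourSixteen SymmetricThreeFourFifteen

/-- **`DD_023_low`**: an identity term carrying `{0,2,3}` and an identity term all of whose letters are `1` or `2` cannot coexist. [hM] -/
theorem DD_023_low {n : ℕ} (r : Fin (n + 1) → Equiv.Perm (Fin 3) × (Fin 3 → Fin 4))
    (hM : ∀ a b : Fin (n + 1), a < b → ∀ l₁ l₂ : Fin 3,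
      ((r a).1 l₁ = (r b).1 l₂ ∧ l₁ = l₂) ∨ ((r a).1 l₁ = l₂ ∧ (r b).1 l₂ = l₁) → (r a).2 l₁ ≤ (r b).2 l₂)
    (b c : Fin (n + 1)) (hb1 : (r b).1 = 1) (hc1 : (r c).1 = 1)
    (hbC : TropicalCensus.classSym (r b) = TropicalCensus.classSym ((1 : Equiv.Perm (Fin 3)), (![0, 2, 3] : Fin 3 → Fin 4)))
    (hc12 : ∀ l, (r c).2 l = 1 ∨ (r c).2 l = 2) : False := by
  have cb : ∀ l, (univ.filter fun x => (r b).2 x = l).card = (![1, 0, 1, 1] : Fin 4 → ℕ) l :=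
    fun l => (card_filter_eq_of_classSym_eq hbC l).trans (cnt023 l)
  obtain ⟨κ0, hκ0⟩ := exists_of_card_pos ((r b).2) 0 (by rw [cb 0]; decide)
  obtain ⟨κ3, hκ3⟩ := exists_of_card_pos ((r b).2) 3 (by rw [cb 3]; decide)
  have hbc : b ≠ c := by
    intro h; rw [h] at hκ0
    rcases hc12 κ0 with h' | h' <;> rw [h'] at hκ0 <;> exact absurd hκ0 (by decide)
  rcases lt_or_gt_of_ne hbc with h | h
  · have hle := hM b c h κ3 κ3 (Or.inl ⟨by rw [hb1, hc1], rfl⟩)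
    rw [hκ3] at hle
    rcases hc12 κ3 with h' | h' <;> rw [h'] at hle <;> exact absurd hle (by decide)
  · have hle := hM c b h κ0 κ0 (Or.inl ⟨by rw [hb1, hc1], rfl⟩)
    rw [hκ0] at hle
    rcases hc12 κ0 with h' | h' <;> rw [h'] at hle <;> exact absurd hle (by decide)

/-- **`K10`**: `{0,0,3}, {1,1,2}, {1,2,2}` on transposition terms against `{0,2,3} = D(w)` is impossible (the single-term core V2 in the
orbit framework): `{1,2,2}` fixes the `2`-column of `w`, then `{1,1,2}` fixes the `2`- or the `3`-column, i.e. shares its transposition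
with `{1,2,2}` or with `{0,0,3}`, and fixed-entry / pair monotonicity fails. [hM, hR1, hR1'] -/
theorem K10 {n : ℕ} (r : Fin (n + 1) → Equiv.Perm (Fin 3) × (Fin 3 → Fin 4)) (g : Fin 4 → ℕ) (hmono : Monotone g)
    (hM : ∀ a b : Fin (n + 1), a < b → ∀ l₁ l₂ : Fin 3,
      ((r a).1 l₁ = (r b).1 l₂ ∧ l₁ = l₂) ∨ ((r a).1 l₁ = l₂ ∧ (r b).1 l₂ = l₁) → (r a).2 l₁ ≤ (r b).2 l₂)
    (hR1 : ∀ a b : Fin (n + 1), a < b → (r a).1 = 1 → ∀ i j : Fin 3, i ≠ j → (r b).1 = Equiv.swap i j → (r b).2 i = (r b).2 j →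
      g ((r a).2 i) + g ((r a).2 j) < 2 * g ((r b).2 i))
    (hR1' : ∀ a b : Fin (n + 1), a < b → (r b).1 = 1 → ∀ i j : Fin 3, i ≠ j → (r a).1 = Equiv.swap i j → (r a).2 i = (r a).2 j →
      2 * g ((r a).2 i) < g ((r b).2 i) + g ((r b).2 j))
    (t b c e : Fin (n + 1)) (hb1 : (r b).1 = 1)
    (htC : TropicalCensus.classSym (r t) = TropicalCensus.classSym ((1 : Equiv.Perm (Fin 3)), (![0, 0, 3] : Fin 3 → Fin 4)))
    (hbC : TropicalCensus.classSym (r b) = TropicalCensus.classSym ((1 : Equiv.Perm (Fin 3)), (![0, 2, 3] : Fin 3 → Fin 4)))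
    (hcC : TropicalCensus.classSym (r c) = TropicalCensus.classSym ((1 : Equiv.Perm (Fin 3)), (![1, 1, 2] : Fin 3 → Fin 4)))
    (heC : TropicalCensus.classSym (r e) = TropicalCensus.classSym ((1 : Equiv.Perm (Fin 3)), (![1, 2, 2] : Fin 3 → Fin 4)))
    {i j : Fin 3} (hij : i < j) (ht1 : (r t).1 = Equiv.swap i j) (htt : (r t).2 i = (r t).2 j)
    {ic jc : Fin 3} (hijc : ic < jc) (hc1 : (r c).1 = Equiv.swap ic jc) (hcc : (r c).2 ic = (r c).2 jc)
    {ie je : Fin 3} (hije : ie < je) (he1 : (r e).1 = Equiv.swap ie je) (hee : (r e).2 ie = (r e).2 je) : False := by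
  obtain ⟨kt, hkti, hktj, htb, hti, htk, hw3, hwij⟩ := TD_frame r g hmono hM hR1 t b hb1 htC hbC hij ht1 htt
  have cb : ∀ l, (univ.filter fun x => (r b).2 x = l).card = (![1, 0, 1, 1] : Fin 4 → ℕ) l :=
    fun l => (card_filter_eq_of_classSym_eq hbC l).trans (cnt023 l)
  have cc : ∀ l, (univ.filter fun x => (r c).2 x = l).card = (![0, 2, 1, 0] : Fin 4 → ℕ) l :=
    fun l => (card_filter_eq_of_classSym_eq hcC l).trans (cnt112 l)
  have ce : ∀ l, (univ.filter fun x => (r e).2 x = l).card = (![0, 1, 2, 0] : Fin 4 → ℕ) l :=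
    fun l => (card_filter_eq_of_classSym_eq heC l).trans (cnt122 l)
  have ct : ∀ l, (univ.filter fun x => (r t).2 x = l).card = (![2, 0, 0, 1] : Fin 4 → ℕ) l :=
    fun l => (card_filter_eq_of_classSym_eq htC l).trans (cnt003 l)
  have wb1 : ∀ l, (r b).2 l ≠ 1 := ne_of_card_zero _ 1 (by rw [cb 1]; rfl)
  have w3u : ∀ x, (r b).2 x = 3 → x = kt := fun x hx => by
    by_contra hne; exact ne_of_card_one _ 3 (by rw [cb 3]; rfl) hw3 hne hx
  have g02 : g 0 ≤ g 2 := hmono (by decide)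
  have g12 : g 1 ≤ g 2 := hmono (by decide)
  have g23 : g 2 ≤ g 3 := hmono (by decide)
  have hij' : i ≠ j := ne_of_lt hij
  have hijc' : ic ≠ jc := ne_of_lt hijc
  have hije' : ie ≠ je := ne_of_lt hije
  obtain ⟨kc, hkci, hkcj⟩ := exists_third ic jc
  obtain ⟨ke, hkei, hkej⟩ := exists_third ie je
  obtain ⟨hci, hck⟩ := swap_letters r c hijc' hkci hkcj hcc 2 1 (by rw [cc 2]; rfl) (by rw [cc 1]; rfl)
    (fun l => (letters12 r c (by rw [cc 0]; rfl) (by rw [cc 3]; rfl) l).symm)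
  obtain ⟨hei, hek⟩ := swap_letters r e hije' hkei hkej hee 1 2 (by rw [ce 1]; rfl) (by rw [ce 2]; rfl)
    (letters12 r e (by rw [ce 0]; rfl) (by rw [ce 3]; rfl))
  have hck' : (r c).1 kc = kc := by rw [hc1, Equiv.swap_apply_of_ne_of_ne hkci hkcj]
  have hek' : (r e).1 ke = ke := by rw [he1, Equiv.swap_apply_of_ne_of_ne hkei hkej]
  have htk' : (r t).1 kt = kt := by rw [ht1, Equiv.swap_apply_of_ne_of_ne hkti hktj]
  have hbe : b ≠ e := by intro h; have := cb 0; rw [h, ce 0] at this; exact absurd this (by decide)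
  have hbc : b ≠ c := by intro h; have := cb 0; rw [h, cc 0] at this; exact absurd this (by decide)
  have hce : c ≠ e := by intro h; have := cc 1; rw [h, ce 1] at this; exact absurd this (by decide)
  have htc : t ≠ c := by intro h; have := ct 0; rw [h, cc 0] at this; exact absurd this (by decide)
  -- `w`-letters off the column `x` with `w x = 0 / 2 / 3`
  have gw_ge2 : ∀ x, (r b).2 x ≠ 0 → g 2 ≤ g ((r b).2 x) := fun x h0 => hmono (f4_g _ h0 (wb1 x))
  -- `e` comes before `D(w)` and fixes the `2`-column of `w`
  have he_b : e < b ∧ (r b).2 ke = 2 := by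
    rcases lt_or_gt_of_ne hbe with h | h
    · exfalso
      have hle := hM b e h ke ke (Or.inl ⟨by rw [hb1, hek', Equiv.Perm.one_apply], rfl⟩)
      rw [hek] at hle
      have hw0 : (r b).2 ke = 0 := f4_f _ hle (wb1 ke)
      have hC := hR1 b e h hb1 ie je hije' he1 hee
      rw [hei] at hC
      have g1 := gw_ge2 ie (ne_of_card_one _ 0 (by rw [cb 0]; rfl) hw0 hkei.symm)
      have g2 := gw_ge2 je (ne_of_card_one _ 0 (by rw [cb 0]; rfl) hw0 hkej.symm)
      omega
    · refine ⟨h, ?_⟩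
      have hle := hM e b h ke ke (Or.inl ⟨by rw [hb1, hek', Equiv.Perm.one_apply], rfl⟩)
      rw [hek] at hle
      have hC := hR1' e b h hb1 ie je hije' he1 hee
      rw [hei] at hC
      by_contra hne2
      have hw3' : (r b).2 ke = 3 := (f4_h _ hle (wb1 ke)).resolve_left hne2
      -- then `ie, je` carry `0` and `2`: `2 g 2 < g 0 + g 2` is absurd
      have hi3 : (r b).2 ie ≠ 3 := ne_of_card_one _ 3 (by rw [cb 3]; rfl) hw3' hkei.symm
      have hj3 : (r b).2 je ≠ 3 := ne_of_card_one _ 3 (by rw [cb 3]; rfl) hw3' hkej.symm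
      have gi : g ((r b).2 ie) ≤ g 2 := hmono (f4_i _ hi3)
      have gj : g ((r b).2 je) ≤ g 2 := hmono (f4_i _ hj3)
      omega
  obtain ⟨heb, hw2⟩ := he_b
  have w2u : ∀ x, (r b).2 x = 2 → x = ke := fun x hx => by
    by_contra hne; exact ne_of_card_one _ 2 (by rw [cb 2]; rfl) hw2 hne hx
  -- the pair of `e` carries the `w`-letters `0` and `3`: `2 g 2 < g 0 + g 3`
  have y2 : 2 * g 2 < g 0 + g 3 := by
    have hC := hR1' e b heb hb1 ie je hije' he1 hee
    rw [hei] at hC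
    have hi2 : (r b).2 ie ≠ 2 := fun hh => hkei.symm (w2u ie hh) |>.elim
    have hj2 : (r b).2 je ≠ 2 := fun hh => hkej.symm (w2u je hh) |>.elim
    rcases f4_c _ (wb1 ie) hi2 with hi0 | hi3 <;> rcases f4_c _ (wb1 je) hj2 with hj0 | hj3
    · have := two_le_card_filter (r b) hije'.symm (hj0.trans hi0.symm); rw [hi0, cb 0] at this; exact absurd this (by decide)
    · rw [hi0, hj3] at hC; omega
    · rw [hi3, hj0] at hC; omega
    · have := two_le_card_filter (r b) hije'.symm (hj3.trans hi3.symm); rw [hi3, cb 3] at this; exact absurd this (by decide)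
  -- `c` comes before `D(w)` and fixes the `2`- or the `3`-column of `w`
  have hcb : c < b := by
    rcases lt_or_gt_of_ne hbc with h | h
    · exfalso
      have hle := hM b c h kc kc (Or.inl ⟨by rw [hb1, hck', Equiv.Perm.one_apply], rfl⟩)
      rw [hck] at hle
      have hC := hR1 b c h hb1 ic jc hijc' hc1 hcc
      rw [hci] at hC
      have hkc3 : (r b).2 kc ≠ 3 := fun hh => by rw [hh] at hle; exact absurd hle (by decide)
      have f4_p : ∀ x : Fin 4, x ≠ 1 → x ≠ 3 → x = 0 ∨ x = 2 := by decide
      rcases f4_p _ (wb1 kc) hkc3 with hkc0 | hkc2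
      · have g1 := gw_ge2 ic (ne_of_card_one _ 0 (by rw [cb 0]; rfl) hkc0 hkci.symm)
        have g2 := gw_ge2 jc (ne_of_card_one _ 0 (by rw [cb 0]; rfl) hkc0 hkcj.symm)
        omega
      · -- `kc = ke`: the pair of `c` carries `0, 3`: `g 0 + g 3 < 2 g 1 ≤ 2 g 2 < g 0 + g 3`
        have hi2 : (r b).2 ic ≠ 2 := ne_of_card_one _ 2 (by rw [cb 2]; rfl) hkc2 hkci.symm
        have hj2 : (r b).2 jc ≠ 2 := ne_of_card_one _ 2 (by rw [cb 2]; rfl) hkc2 hkcj.symm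
        rcases f4_c _ (wb1 ic) hi2 with hi0 | hi3 <;> rcases f4_c _ (wb1 jc) hj2 with hj0 | hj3
        · have := two_le_card_filter (r b) hijc'.symm (hj0.trans hi0.symm); rw [hi0, cb 0] at this; exact absurd this (by decide)
        · rw [hi0, hj3] at hC; omega
        · rw [hi3, hj0] at hC; omega
        · have := two_le_card_filter (r b) hijc'.symm (hj3.trans hi3.symm); rw [hi3, cb 3] at this; exact absurd this (by decide)
    · exact h
  have hle_c := hM c b hcb kc kc (Or.inl ⟨by rw [hb1, hck', Equiv.Perm.one_apply], rfl⟩)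
  rw [hck] at hle_c
  have swap_ne_one : ∀ {x y : Fin 3}, x ≠ y → Equiv.swap x y ≠ (1 : Equiv.Perm (Fin 3)) := fun {x y} hxy h =>
    hxy (Equiv.swap_eq_refl_iff.mp h)
  rcases f4_h _ (le_trans (by decide) hle_c) (wb1 kc) with hkc2 | hkc3
  · -- `kc = ke`: `c` and `e` share their transposition
    have hkk : kc = ke := w2u kc hkc2
    have hperm : (r c).1 = (r e).1 :=
      perm_three_eq_of_fixed _ _ (by rw [hc1]; exact swap_ne_one hijc') (by rw [he1]; exact swap_ne_one hije') kc hck'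
        (by rw [hkk]; exact hek')
    rcases lt_or_gt_of_ne hce with h | h
    · have hle := hM c e h kc kc (Or.inl ⟨by rw [hperm], rfl⟩)
      rw [hck, hkk, hek] at hle; exact absurd hle (by decide)
    · have hle := hM e c h ic ic (Or.inl ⟨by rw [hperm], rfl⟩)
      rw [hci] at hle
      have hic2 : (r e).2 ic = 2 := by
        rcases eq_or_eq_of_ne_third ie je ke ic hije' hkei.symm hkej.symm (by rw [← hkk]; exact hkci.symm) with hh | hh
        · rw [hh]; exact hei
        · rw [hh, ← hee]; exact hei
      rw [hic2] at hle; exact absurd hle (by decide)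
  · -- `kc = kt`: `c` and `t` share their transposition
    have hkk : kc = kt := w3u kc hkc3
    have hperm : (r c).1 = (r t).1 :=
      perm_three_eq_of_fixed _ _ (by rw [hc1]; exact swap_ne_one hijc') (by rw [ht1]; exact swap_ne_one hij') kc hck'
        (by rw [hkk]; exact htk')
    rcases lt_or_gt_of_ne htc with h | h
    · have hle := hM t c h kt kt (Or.inl ⟨by rw [hperm], rfl⟩)
      rw [htk, ← hkk, hck] at hle; exact absurd hle (by decide)
    · have hle := hM c t h ic ic (Or.inl ⟨by rw [hperm], rfl⟩)
      rw [hci] at hle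
      have hic0 : (r t).2 ic = 0 := by
        rcases eq_or_eq_of_ne_third i j kt ic hij' hkti.symm hktj.symm (by rw [← hkk]; exact hkci.symm) with hh | hh
        · rw [hh]; exact hti
        · rw [hh, ← htt]; exact hti
      rw [hic0] at hle; exact absurd hle (by decide)

/-- **ORBIT CORE V2 (`orbV2`).**  Under the orbit-chain hypotheses, `{0,0,3}, {0,2,3}, {1,1,2}, {1,2,2}` are not all carried.
[typed case tree of the blueprint: C_extreme_D, CC_low_high, DD_023_low, K4, K5, K6, K7, K8, K9, K10] -/
theorem orbV2 {n : ℕ} (r : Fin (n + 1) → Equiv.Perm (Fin 3) × (Fin 3 → Fin 4)) (g : Fin 4 → ℕ) (hmono : Monotone g)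
    (hshape : ∀ k, (r k).1 = 1 ∨ (∃ i j : Fin 3, i < j ∧ (r k).1 = Equiv.swap i j ∧ (r k).2 i = (r k).2 j) ∨ (∀ i, (r k).1 i ≠ i))
    (hM : ∀ a b : Fin (n + 1), a < b → ∀ l₁ l₂ : Fin 3,
      ((r a).1 l₁ = (r b).1 l₂ ∧ l₁ = l₂) ∨ ((r a).1 l₁ = l₂ ∧ (r b).1 l₂ = l₁) → (r a).2 l₁ ≤ (r b).2 l₂)
    (hR1 : ∀ a b : Fin (n + 1), a < b → (r a).1 = 1 → ∀ i j : Fin 3, i ≠ j → (r b).1 = Equiv.swap i j → (r b).2 i = (r b).2 j →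
      g ((r a).2 i) + g ((r a).2 j) < 2 * g ((r b).2 i))
    (hR1' : ∀ a b : Fin (n + 1), a < b → (r b).1 = 1 → ∀ i j : Fin 3, i ≠ j → (r a).1 = Equiv.swap i j → (r a).2 i = (r a).2 j →
      2 * g ((r a).2 i) < g ((r b).2 i) + g ((r b).2 j))
    (hR2 : ∀ a b : Fin (n + 1), a < b → ∀ i j k : Fin 3, i ≠ j → k ≠ i → k ≠ j → (r a).1 = Equiv.swap i j →
      (r a).2 i = (r a).2 j → (r b).1 i = j → (r b).1 j = k → (r b).1 k = i →
      g ((r a).2 k) + g ((r a).2 i) < g ((r b).2 j) + g ((r b).2 k))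
    (hR2' : ∀ a b : Fin (n + 1), a < b → ∀ i j k : Fin 3, i ≠ j → k ≠ i → k ≠ j → (r a).1 i = j → (r a).1 j = k → (r a).1 k = i →
      (r b).1 = Equiv.swap i j → (r b).2 i = (r b).2 j → g ((r a).2 j) + g ((r a).2 k) < g ((r b).2 k) + g ((r b).2 i))
    (hR3 : ∀ a b : Fin (n + 1), a < b → (r a).1 = 1 → ∀ i j k : Fin 3, i ≠ j → k ≠ i → k ≠ j →
      (r b).1 i = j → (r b).1 j = k → (r b).1 k = i → g ((r a).2 i) + g ((r a).2 j) < 2 * g ((r b).2 i))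
    (hR3' : ∀ a b : Fin (n + 1), a < b → (r b).1 = 1 → ∀ i j k : Fin 3, i ≠ j → k ≠ i → k ≠ j →
      (r a).1 i = j → (r a).1 j = k → (r a).1 k = i → 2 * g ((r a).2 i) < g ((r b).2 i) + g ((r b).2 j))
    (z b c e : Fin (n + 1))
    (hzC : TropicalCensus.classSym (r z) = TropicalCensus.classSym ((1 : Equiv.Perm (Fin 3)), (![0, 0, 3] : Fin 3 → Fin 4)))
    (hbC : TropicalCensus.classSym (r b) = TropicalCensus.classSym ((1 : Equiv.Perm (Fin 3)), (![0, 2, 3] : Fin 3 → Fin 4)))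
    (hcC : TropicalCensus.classSym (r c) = TropicalCensus.classSym ((1 : Equiv.Perm (Fin 3)), (![1, 1, 2] : Fin 3 → Fin 4)))
    (heC : TropicalCensus.classSym (r e) = TropicalCensus.classSym ((1 : Equiv.Perm (Fin 3)), (![1, 2, 2] : Fin 3 → Fin 4))) : False := by
  have cz : ∀ l, (univ.filter fun x => (r z).2 x = l).card = (![2, 0, 0, 1] : Fin 4 → ℕ) l :=
    fun l => (card_filter_eq_of_classSym_eq hzC l).trans (cnt003 l)
  have cb : ∀ l, (univ.filter fun x => (r b).2 x = l).card = (![1, 0, 1, 1] : Fin 4 → ℕ) l :=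
    fun l => (card_filter_eq_of_classSym_eq hbC l).trans (cnt023 l)
  have cc : ∀ l, (univ.filter fun x => (r c).2 x = l).card = (![0, 2, 1, 0] : Fin 4 → ℕ) l :=
    fun l => (card_filter_eq_of_classSym_eq hcC l).trans (cnt112 l)
  have ce : ∀ l, (univ.filter fun x => (r e).2 x = l).card = (![0, 1, 2, 0] : Fin 4 → ℕ) l :=
    fun l => (card_filter_eq_of_classSym_eq heC l).trans (cnt122 l)
  obtain ⟨z0, hz0⟩ := exists_of_card_pos ((r z).2) 0 (by rw [cz 0]; decide)
  obtain ⟨z3, hz3⟩ := exists_of_card_pos ((r z).2) 3 (by rw [cz 3]; decide)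
  obtain ⟨b0, hb0⟩ := exists_of_card_pos ((r b).2) 0 (by rw [cb 0]; decide)
  obtain ⟨b3, hb3⟩ := exists_of_card_pos ((r b).2) 3 (by rw [cb 3]; decide)
  have c12 := letters12 r c (by rw [cc 0]; rfl) (by rw [cc 3]; rfl)
  have e12 := letters12 r e (by rw [ce 0]; rfl) (by rw [ce 3]; rfl)
  have c_lo : ∀ l, (r c).2 l ≠ 0 := ne_of_card_zero _ 0 (by rw [cc 0]; rfl)
  have c_hi : ∀ l, (r c).2 l ≠ 3 := ne_of_card_zero _ 3 (by rw [cc 3]; rfl)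
  have e_lo : ∀ l, (r e).2 l ≠ 0 := ne_of_card_zero _ 0 (by rw [ce 0]; rfl)
  have e_hi : ∀ l, (r e).2 l ≠ 3 := ne_of_card_zero _ 3 (by rw [ce 3]; rfl)
  have hbshape : (r b).1 = 1 ∨ ∀ i, (r b).1 i ≠ i := by
    rcases hshape b with h | h | h
    · exact Or.inl h
    · exact absurd h (not_swap_of_counts_le_one r b fun l => by rw [cb l]; fin_cases l <;> decide)
    · exact Or.inr h
  rcases hbshape with hb1 | hbC'
  · rcases hshape z with hz1 | ⟨i, j, hij, hzs, hzz⟩ | hzC'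
    · -- `{0,0,3} = D`
      rcases hshape c with hc1 | hcT | hcC'
      · exact DD_023_low r hM b c hb1 hc1 hbC c12
      · rcases hshape e with he1 | ⟨i', j', hij', hes, hee⟩ | heC'
        · exact DD_023_low r hM b e hb1 he1 hbC e12
        · exact K7 r g hmono hM hR1 hR1' z b e hz1 hb1 hzC hbC heC hij' hes hee
        · exact K6 r g hmono hM hR3 hR3' z b e hz1 hb1 heC' hzC hbC heC
      · exact K5 r g hmono hM hR3 hR3' z b c hz1 hb1 hcC' hzC hbC hcC
    · -- `{0,0,3} = T`
      rcases hshape c with hc1 | ⟨ic, jc, hijc, hcs, hcc⟩ | hcC'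
      · exact DD_023_low r hM b c hb1 hc1 hbC c12
      · rcases hshape e with he1 | ⟨ie, je, hije, hes, hee⟩ | heC'
        · exact DD_023_low r hM b e hb1 he1 hbC e12
        · exact K10 r g hmono hM hR1 hR1' z b c e hb1 hzC hbC hcC heC hij hzs hzz hijc hcs hcc hije hes hee
        · exact K8 r g hmono hM hR1 hR2 hR2' hR3 hR3' z b e hb1 heC' hzC hbC heC hij hzs hzz
      · rcases hshape e with he1 | heT | heC'
        · exact DD_023_low r hM b e hb1 he1 hbC e12
        · exact K9 r g hmono hM hR1 hR1' hR2 hR2' z b c e hb1 hcC' hzC hbC hcC heC hij hzs hzz (Or.inr heT)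
        · exact K8 r g hmono hM hR1 hR2 hR2' hR3 hR3' z b e hb1 heC' hzC hbC heC hij hzs hzz
    · exact C_extreme_D r g hmono hR3 hR3' b z hb1 hzC' z0 z3 hz0 hz3
  · -- `{0,2,3}` on a pair carrier
    rcases hshape c with hc1 | ⟨ic, jc, hijc, hcs, hcc⟩ | hcC'
    · exact C_extreme_D r g hmono hR3 hR3' c b hc1 hbC' b0 b3 hb0 hb3
    · rcases hshape e with he1 | ⟨ie, je, hije, hes, hee⟩ | heC'
      · exact C_extreme_D r g hmono hR3 hR3' e b he1 hbC' b0 b3 hb0 hb3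
      · exact K4 r g hmono hM hR2 hR2' b c e hbC' hbC hcC heC hijc hcs hcc hije hes hee
      · exact CC_low_high r hM e b heC' hbC' e_lo e_hi b0 b3 hb0 hb3
    · exact CC_low_high r hM c b hcC' hbC' c_lo c_hi b0 b3 hb0 hb3

end SymmetricOrbitThreeFour

end Summit.ValiantsHypothesis.ValiantsHypothesis.Theorems.KPlusLogSqLaw
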